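import Literature.NumberTheory.LocalFields.UnramifiedQuadraticOrderUnitIndex
import Literature.NumberTheory.Rogawski1990.UnitOrbitalIntegralInertPiecewise
import HarnessLib

/-!
# The Cor. 9 weight `w(j)` IS the order unit index `[R_E^× : R_E(j)^×]` (Flicker 1998, Prop. 7 + Cor. 9 p. 85) — bridge file

Topic `NumberTheory/Rogawski1990`, namespace `Literature.NumberTheory.Rogawski1990.Flicker1998` (as ★ `UnitOrbitalIntegralInertPiecewise`).  THEOREMS
ONLY: no definition, no named fact, no instance, no notation, no `sorry`.  Cell `pub/hodgecm-mathlib`, F0∕P3a road «D-N7-inert», MAP v3 §2 (F3a)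
bridge asked by A-p03 (g24) 04:04:26Z (LAYER C = Cor. 9 assembly multiplies by exactly the token `Flicker1998.corNineWeight q j`).  It joins ★
`LocalFields/UnramifiedQuadraticOrderUnitIndex` (Prop. 7: the index of `R_E(j)^× = {u : σ u − u ∈ 𝔪^j}` in `R_E^×` is `1` for `j = 0` and
`q^{j−1}(q+1)` for `j ≥ 1`) to ★ `corNineWeight q j = if j = 0 then 1 else (1 + q⁻¹) q^j`.  HC_CM is proved only modulo the printed citations until
rung 0 closes; nothing printed is a letter here.

* **`index_orderUnits_eq_corNineWeight`** — for EVERY `j : ℕ`: `(([R_E^× : R_E(j)^×] : ℕ) : ℚ) = corNineWeight q j`.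
* **`prop8_index_value_eq`** — Prop. 8's `[P_H : P_H ∩ H^K_m] = [R_E^× : 1 + π^m R_E] · [R : π^{2m} R]` has the value `(1 − q⁻²) q^{4m}` (`m ≥ 1`), with the
  first factor READ as ★ `natCard_units_quotient_pow` (`|(R_E ⧸ 𝔪^m)ˣ| = (q²)^{m−1}(q²−1)`) and the second as ★ FILE 1's `|Fix σ̄_{2m}| = q^{2m}`
  (`= |R ⧸ π^{2m} R|`, the fixed ring's quotient counted inside `R_E ⧸ 𝔪^{2m}`); spelled `(1 - ((q:ℚ)^2)⁻¹) * (q:ℚ)^(4*m)` verbatim as A-p03 reads it.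

## References
* [Flicker1998UnitaryFL] Y. Z. Flicker, *Elementary proof of the fundamental lemma for a unitary group*, Canad. J. Math. 50 (1998), Prop. 7–8 pp. 84–85, Cor. 9 p. 85.
-/

set_option autoImplicit false

namespace Literature.NumberTheory.Rogawski1990.Flicker1998

open Literature.NumberTheory.LocalFields.UnramifiedQuadraticNorm Literature.NumberTheory.GaloisRepresentations IsLocalRing

universe u

variable {R : Type u} [CommRing R] [IsDomain R] [IsDiscreteValuationRing R] [Finite (ResidueField R)] (σ : R →+* R)
  (hσ : ∀ a, σ (σ a) = a) {a : R} (ha : IsUnit (σ a - a)) {q : ℕ} (hq : Nat.card (ResidueField R) = q ^ 2)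

include ha hq in
/-- **`[R_E^× : R_E(j)^×] = w(j)` for every `j`** — the unit index of Flicker's order `R_E(j) = R + π^j R_E = {x : σ x − x ∈ 𝔪^j}` in `R_E^×`
(★ `index_comap_eqLocus_zero`, ★ `index_comap_eqLocus_eq_rat`) equals the Cor. 9 weight ★ `corNineWeight q j = δ_{j0} + (1 + q⁻¹) q^j δ_{j ≥ 1}`.
[cite: Flicker1998UnitaryFL, Prop. 7 p. 84, Cor. 9 p. 85] -/
theorem index_orderUnits_eq_corNineWeight (j : ℕ) :
    ((((Units.map (Ideal.quotientMap (maximalIdeal R ^ j) σ (maximalIdeal_pow_le_comap σ hσ j)).toMonoidHom).eqLocus (MonoidHom.id _)).comap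
        (Units.map (Ideal.Quotient.mk (maximalIdeal R ^ j)).toMonoidHom)).index : ℚ) = corNineWeight q j := by
  unfold corNineWeight
  rcases Nat.eq_zero_or_pos j with rfl | hj
  · rw [index_comap_eqLocus_zero σ hσ, if_pos rfl, Nat.cast_one]
  · rw [index_comap_eqLocus_eq_rat σ hσ ha hq hj, if_neg (by omega)]

include hσ ha hq in
/-- **PROP. 8's VALUE.**  For `m ≥ 1`: `|(R_E ⧸ 𝔪^m)ˣ| · |Fix σ̄_{2m}| = (q²)^{m−1}(q²−1) · q^{2m} = (1 − q⁻²) q^{4m}` — Flicker's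
`[P_H : P_H ∩ H^K_m] = [R_E^× : 1 + π^m R_E] · [R : π^{2m} R]`, the two factors read as ★ `natCard_units_quotient_pow` and ★ `natCard_fixed_quotient_pow`.
[cite: Flicker1998UnitaryFL, Prop. 8 pp. 84–85] -/
theorem prop8_index_value_eq {m : ℕ} (hm : 1 ≤ m) :
    ((Nat.card (R ⧸ maximalIdeal R ^ m)ˣ *
        Nat.card {x : R ⧸ maximalIdeal R ^ (2 * m) //
          Ideal.quotientMap (maximalIdeal R ^ (2 * m)) σ (maximalIdeal_pow_le_comap σ hσ (2 * m)) x = x} : ℕ) : ℚ) =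
      (1 - ((q : ℚ) ^ 2)⁻¹) * (q : ℚ) ^ (4 * m) := by
  rw [natCard_units_quotient_pow hq hm, natCard_fixed_quotient_pow σ hσ ha hq (2 * m)]
  have h2 := index_comap_eqLocus_eq.two_le_q' (R := R) hq
  exact flicker_prop8_value (by omega) hm

end Literature.NumberTheory.Rogawski1990.Flicker1998
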